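import Summits.BirchSwinnertonDyer.Rank1Residual.X1.LocalPackageTransportPoints
import Summits.BirchSwinnertonDyer.Rank1Residual.X1.AnomalousReduction
import Summits.BirchSwinnertonDyer.Rank1Residual.X1.LocalKerOverAtPConj
import Summits.BirchSwinnertonDyer.Rank1Residual.Additive.ZpTowerSeam
import HarnessLib

/-!
# LP-C (Galois side): the transport `θ = ι₂(·)ι₂⁻¹` is ONTO `Γ_{L_w}`; the local Galois group of
# `L_w` fixes the reductions of `E[p]` (anomalous prime); the cyclotomic-tower character is a unit
# on some inertia element of `L_w`; no `Γ_{L_w}`-fixed `p`-th root of unity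
# (cell `b2b-bsdres`, unit `b2b-bsdres-eisenstein-p1`, gen 20; X1R0-GAPMAP §28.4 (LP-B/C/D), §29)

HONEST FRAMING (run/shared/lean/b2b/bsd-rank1-residual/, verbatim in every file): the goal of the
cell is to DELETE the COMBINATION-SHAPED residual classes of the Birch–Swinnerton-Dyer formula for
ALL analytic-rank `≤ 1` elliptic curves over `ℚ` — "full BSD formula for every rank `≤ 1` curve in
class `C`" assembled STRICTLY from published theorems — so that the rank-`≤ 1` remainder becomes
exactly the CONSTRUCTION-SHAPED classes, which are TYPED (missing-input `Prop`s), NOT attempted.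
This is not "finishing BSD". Sub-cell `b2b-bsdres-eisenstein-p1`: research route; NO CLAIM BEYOND
STATED CLASSES; nothing here changes a label; nothing is booked. THEOREMS ONLY — no definition, no
named fact; the factorisation data `(ι₂, ι', hfix)` are HYPOTHESES (n1011's
`Additive/LocalSubgroupTransport` / `ZpTowerSelmerTransport` shape), as is the `L_w`-side reduction
datum `(red, hred)` (`X1/LocalReductionStrict` shape).

## What and why

Discharges, over `ℚ` with `κ` the cyclotomic `ℤ_p`-extension, `L = ℚ_n = κ.layer n`, `v ∋ p`,
`wp ∣ v`, of three hypotheses of the `K`-general local package `X1/LocalStrictPackage`: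

* §1 `exists_transportAut_eq` — `θ : h ↦ ι₂ h ι₂⁻¹` maps `{h ∈ Γ_{ℚ_v} | res h ∈ Gal(\bar ℚ/ℚ_n)}`
  ONTO `Γ_{L_w}`; §2 **`red_pointsMap_smul_eq`** (`hs_anom`): at an ANOMALOUS good ordinary `p`,
  `red(pointsMap(g • Q)) = red(pointsMap Q)` for `g ∈ Γ_{L_w}`, `Q ∈ E[p]` (X1's
  `localRed_smul_eq_of_anomalous` over `ℚ_v`, transported; the conjugator `τ` of `ι' = ι_{L_w} ∘ τ`
  cancels); §3 **`exists_absInertia_not_dvd`** (`hI`): some `g ∈ I_{L_w}` has `κ_n(res g) ∈ ℤ_pˣ`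
  (`Γ_ℚ = res(I_{ℚ_v})·ker κ`, FILE 22), **`forall_mu_eq_zero`** (`hμ`, `p` odd): an inertia
  element of `ℚ_v` with cyclotomic character `−1` lies under `ker κ` and inverts `μ_p`.

References: [GreenbergLNM1716] §3 Lemma 3.4; [SerreLocalFields1979] IV §4 Prop. 17; [Washington1997] §13.1.
-/

noncomputable section

open scoped Classical NNReal

open Function Field NumberField IsDedekindDomain WeierstrassCurve
  Literature.NumberTheory.EllipticCurves Literature.NumberTheory.GaloisRepresentations
  IsDedekindDomain.HeightOneSpectrum
  Summit.BirchSwinnertonDyer.Rank1Residual.Additive.LocalTransport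
  Summit.BirchSwinnertonDyer.Rank1Residual.Additive
  Summit.BirchSwinnertonDyer.Rank1Residual.Additive.ZpTower
  Summit.BirchSwinnertonDyer.Rank1Residual.X2.GreenbergVatsalReductionDatum
open Literature.NumberTheory.GaloisRepresentations.DiscreteGaloisModule (mu MuCarrier)

set_option autoImplicit false

namespace Summit.BirchSwinnertonDyer.Rank1Residual.X1.LocalPackageTransportGalois

variable (W : WeierstrassCurve ℚ) [W.IsElliptic] [W.IsGloballyMinimal] {p : ℕ} [hp : Fact p.Prime]
  (κ : ZpExtension ℚ p) (n : ℕ) (κn : ZpExtension (κ.layer n) p)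
  (hκn : ∀ σ : Field.absoluteGaloisGroup (κ.layer n),
    (κn σ).toAdd * (p : ℤ_[p]) ^ n = (κ (resGal (K := ℚ) (κ.layer n) σ)).toAdd)
  {v : HeightOneSpectrum (𝓞 ℚ)} (hpv : ((p : ℕ) : 𝓞 ℚ) ∈ v.asIdeal)
  (hΔ : ¬ (p : ℤ) ∣ minimalDiscriminantInt W)
  (wp : HeightOneSpectrum (𝓞 (κ.layer n))) [wp.asIdeal.LiesOver v.asIdeal]
  -- the `L_w`-side reduction datum (`X1/LocalReductionStrict` shape)
  {w' : Valuation (AlgebraicClosure (wp.adicCompletion (κ.layer n))) ℝ≥0}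
  (hw' : ∀ x, (w' x : ℝ) = spectralNorm (wp.adicCompletion (κ.layer n))
    (AlgebraicClosure (wp.adicCompletion (κ.layer n))) x)
  {M' : WeierstrassCurve ↥w'.valuationSubring}
  (hMK' : M'.baseChange (AlgebraicClosure (wp.adicCompletion (κ.layer n))) =
    (W.baseChange (κ.layer n)).baseChange (AlgebraicClosure (wp.adicCompletion (κ.layer n))))
  {red : localPoints (W.baseChange (κ.layer n)) (wp.adicCompletion (κ.layer n)) →+
    (M'.map (IsLocalRing.residue ↥w'.valuationSubring)).toAffine.Point}
  (hred : ∀ P, red P = M'.reducePoint (Affine.Point.congrEquiv hMK'.symm P))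
  -- the factorisation data (n1011 shape)
  (ι₂ : AlgebraicClosure (v.adicCompletion ℚ) ≃+* AlgebraicClosure (wp.adicCompletion (κ.layer n)))
  (hι₂ : ∀ x : v.adicCompletion ℚ,
    ι₂ (algebraMap (v.adicCompletion ℚ) (AlgebraicClosure (v.adicCompletion ℚ)) x) =
      algebraMap (wp.adicCompletion (κ.layer n)) (AlgebraicClosure (wp.adicCompletion (κ.layer n)))
        (adicCompletionMap (K := ℚ) (κ.layer n) v wp x))
  (ι' : AlgebraicClosure (κ.layer n) →ₐ[κ.layer n] AlgebraicClosure (wp.adicCompletion (κ.layer n)))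
  (hcompat : ∀ z : AlgebraicClosure ℚ,
    ι' (closureEmb (K := ℚ) (κ.layer n) z) = ι₂ (closureEmb (K := ℚ) (v.adicCompletion ℚ) z))
  (hfix : ∀ h : absoluteGaloisGroup (v.adicCompletion ℚ),
    resGalOfEmb (closureEmb (K := ℚ) (v.adicCompletion ℚ)) h ∈ κ.layerSubgroup n →
    ∀ y : wp.adicCompletion (κ.layer n),
      (show AlgebraicClosure (v.adicCompletion ℚ) ≃ₐ[v.adicCompletion ℚ]
          AlgebraicClosure (v.adicCompletion ℚ) from h)
        (ι₂.symm (algebraMap _ (AlgebraicClosure (wp.adicCompletion (κ.layer n))) y)) =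
        ι₂.symm (algebraMap _ (AlgebraicClosure (wp.adicCompletion (κ.layer n))) y))

/-! ## §1. `θ` is onto `Γ_{L_w}` -/

include hι₂ hcompat in
/-- **Every `g ∈ Γ_{L_w}` is a transport `ι₂ h ι₂⁻¹`** of some `h ∈ Γ_{ℚ_v}` restricting into
`Gal(\bar ℚ/ℚ_n)`: `h := ι₂⁻¹ g ι₂` is `ℚ_v`-linear (`ι₂ ∘ (ℚ_v → \bar ℚ_v) = (L_w → \bar L_w) ∘ f`,
`g` fixes `L_w`), fixes `ι₂⁻¹(L_w)`, and `res h = resGal ℚ_n (res_{ι'} g)`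
(`resGal_resGalOfEmb_transportAut`). [cite: SerreGaloisCohomology1997, II.§1.1] -/
theorem exists_transportAut_eq [NumberField (κ.layer n)]
    (g : absoluteGaloisGroup (wp.adicCompletion (κ.layer n))) :
    ∃ (h : absoluteGaloisGroup (v.adicCompletion ℚ))
      (hh : ∀ y : wp.adicCompletion (κ.layer n),
        (show AlgebraicClosure (v.adicCompletion ℚ) ≃ₐ[v.adicCompletion ℚ]
            AlgebraicClosure (v.adicCompletion ℚ) from h)
          (ι₂.symm (algebraMap _ (AlgebraicClosure (wp.adicCompletion (κ.layer n))) y)) =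
          ι₂.symm (algebraMap _ (AlgebraicClosure (wp.adicCompletion (κ.layer n))) y)),
      resGalOfEmb (closureEmb (K := ℚ) (v.adicCompletion ℚ)) h ∈ κ.layerSubgroup n ∧
      transportAut ι₂ h hh = g := by
  set Lw := wp.adicCompletion (κ.layer n)
  let ge : AlgebraicClosure Lw ≃ₐ[Lw] AlgebraicClosure Lw := g
  let h0 : AlgebraicClosure (v.adicCompletion ℚ) ≃+* AlgebraicClosure (v.adicCompletion ℚ) :=
    ι₂.trans ((ge : AlgebraicClosure Lw ≃+* AlgebraicClosure Lw).trans ι₂.symm)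
  have h0_apply : ∀ x, h0 x = ι₂.symm (ge (ι₂ x)) := fun _ ↦ rfl
  have hcomm : ∀ x : v.adicCompletion ℚ,
      h0 (algebraMap (v.adicCompletion ℚ) (AlgebraicClosure (v.adicCompletion ℚ)) x) =
        algebraMap (v.adicCompletion ℚ) (AlgebraicClosure (v.adicCompletion ℚ)) x := by
    intro x
    rw [h0_apply, hι₂, ge.commutes, ← hι₂, RingEquiv.symm_apply_apply]
  let h : absoluteGaloisGroup (v.adicCompletion ℚ) :=
    show AlgebraicClosure (v.adicCompletion ℚ) ≃ₐ[v.adicCompletion ℚ]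
      AlgebraicClosure (v.adicCompletion ℚ) from { h0 with commutes' := hcomm }
  have happly : ∀ x, (show AlgebraicClosure (v.adicCompletion ℚ) ≃ₐ[v.adicCompletion ℚ]
      AlgebraicClosure (v.adicCompletion ℚ) from h) x = ι₂.symm (ge (ι₂ x)) := fun _ ↦ rfl
  have hh : ∀ y : Lw, (show AlgebraicClosure (v.adicCompletion ℚ) ≃ₐ[v.adicCompletion ℚ]
      AlgebraicClosure (v.adicCompletion ℚ) from h)
        (ι₂.symm (algebraMap Lw (AlgebraicClosure Lw) y)) =
        ι₂.symm (algebraMap Lw (AlgebraicClosure Lw) y) := by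
    intro y
    rw [happly, RingEquiv.apply_symm_apply, ge.commutes]
  have hθ : transportAut ι₂ h hh = g := by
    apply AlgEquiv.ext
    intro x
    rw [transportAut_apply, happly, RingEquiv.apply_symm_apply, RingEquiv.apply_symm_apply]
  refine ⟨h, hh, ?_, hθ⟩
  rw [← galRange_layer_eq_layerSubgroup κ n, mem_galRange_iff]
  exact ⟨resGalOfEmb ι' (transportAut ι₂ h hh),
    resGal_resGalOfEmb_transportAut (κ.layer n) (closureEmb (K := ℚ) (v.adicCompletion ℚ)) ι₂ ι'
      hcompat h hh⟩

/-! ## §2. `hs_anom`: `Γ_{L_w}` does not change the reductions of `E[p]` (anomalous `p`) -/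

include hpv hΔ hι₂ hcompat hw' hred in
/-- **`red ((ι')_* ((res_{ι'} g) • Q − Q)) = Õ`** for `g ∈ Γ_{L_w}`, `Q ∈ E[p]`, at an anomalous good
ordinary `v ∋ p` (`p ∤ Δ_E`, `p ∤ a_p`, `p ∣ #Ẽ(𝔽_p)`): `g = ι₂ h ι₂⁻¹` (§1),
`res_{ι'} g • βP − βP = β(res h • P − P)` (`primaryBaseChangeEquiv_smul`), transport to `ℚ_v`
(`red_pointsMapOfEmb_eq_zero_iff`), and `localRed (h • P_v) = localRed P_v`
(X1 `localRed_smul_eq_of_anomalous`). [cite: GreenbergLNM1716, §3 Lemma 3.4 (p. 89)]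
[cite: Mazur1972, §5] -/
theorem red_pointsMapOfEmb_smul_sub_eq_zero [NumberField (κ.layer n)]
    (hord : ¬ (p : ℤ) ∣ W.frobeniusTrace p) (hanom : p ∣ W.reductionPointCount p)
    (hΔ' : IsUnit M'.Δ) (g : absoluteGaloisGroup (wp.adicCompletion (κ.layer n)))
    (Q : geomTorsion (W.baseChange (κ.layer n)) (p : ℤ)) :
    red (pointsMapOfEmb (W.baseChange (κ.layer n)) ι'
      (((resGalOfEmb ι' g • Q : geomTorsion (W.baseChange (κ.layer n)) (p : ℤ)) :
          WeierstrassCurve.geomPoints (W.baseChange (κ.layer n))) -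
        (Q : WeierstrassCurve.geomPoints (W.baseChange (κ.layer n))))) = 0 := by
  obtain ⟨h, hh, hmem, hθ⟩ := exists_transportAut_eq κ n wp ι₂ hι₂ ι' hcompat g
  have hx : resGal (K := ℚ) (κ.layer n) (resGalOfEmb ι' g) =
      resGalOfEmb (closureEmb (K := ℚ) (v.adicCompletion ℚ)) h := by
    rw [← hθ]
    exact resGal_resGalOfEmb_transportAut (κ.layer n) (closureEmb (K := ℚ) (v.adicCompletion ℚ))
      ι₂ ι' hcompat h hh
  let Qh : geomPrimaryTorsion (W.baseChange (κ.layer n)) p :=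
    AddSubgroup.inclusion (geomTorsion_le_geomPrimaryTorsion (W.baseChange (κ.layer n)) p) Q
  obtain ⟨P, hP⟩ : ∃ P : W.geomPrimaryTorsion p, primaryBaseChangeEquiv (κ.layer n) W p P = Qh :=
    ⟨_, AddEquiv.apply_symm_apply _ Qh⟩
  have ha : resGalOfEmb ι' g • Qh = primaryBaseChangeEquiv (κ.layer n) W p
      (resGalToRange (K := ℚ) (κ.layer n) (resGalOfEmb ι' g) • P) := by
    rw [primaryBaseChangeEquiv_smul, hP]
  have hb : ((resGalOfEmb ι' g • Q : geomTorsion (W.baseChange (κ.layer n)) (p : ℤ)) :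
        WeierstrassCurve.geomPoints (W.baseChange (κ.layer n))) -
      (Q : WeierstrassCurve.geomPoints (W.baseChange (κ.layer n))) =
      ((primaryBaseChangeEquiv (κ.layer n) W p
          (resGalToRange (K := ℚ) (κ.layer n) (resGalOfEmb ι' g) • P - P) :
        geomPrimaryTorsion (W.baseChange (κ.layer n)) p) :
          WeierstrassCurve.geomPoints (W.baseChange (κ.layer n))) := by
    rw [map_sub, ← ha, hP]
    rfl
  rw [hb, LocalPackageTransportPoints.red_pointsMapOfEmb_eq_zero_iff W p hpv hΔ (κ.layer n) wp
    hw' hMK' hred ι₂ hι₂ ι' hcompat hΔ']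
  -- on the `ℚ_v` side: `localRed (h • P_v − P_v) = 0`
  have h2 : (((resGalToRange (K := ℚ) (κ.layer n) (resGalOfEmb ι' g) • P - P :
      W.geomPrimaryTorsion p)) : W.geomPoints) =
      resGal (K := ℚ) (v.adicCompletion ℚ) h • (P : W.geomPoints) - (P : W.geomPoints) := by
    rw [AddSubgroupClass.coe_sub, Subgroup.smul_def,
      Literature.NumberTheory.EllipticCurves.primaryComponent.coe_smul, coe_resGalToRange, hx]
    rfl
  have hPtors : (p : ℤ) • pointsMap W (v.adicCompletion ℚ) (P : W.geomPoints) = 0 := by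
    rw [← map_zsmul]
    have hQ0 : (p : ℤ) • Qh = 0 := by
      apply Subtype.ext
      change (p : ℤ) • (Q : WeierstrassCurve.geomPoints (W.baseChange (κ.layer n))) = 0
      exact (mem_geomTorsion_iff (W.baseChange (κ.layer n)) (p : ℤ) _).mp Q.2
    have hP0 : (p : ℤ) • P = 0 := by
      apply (primaryBaseChangeEquiv (κ.layer n) W p).injective
      rw [map_zsmul, hP, hQ0, map_zero]
    have : (p : ℤ) • (P : W.geomPoints) = 0 := by
      rw [← AddSubgroupClass.coe_zsmul, hP0]; rfl
    rw [this, map_zero]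
  rw [h2, map_sub, pointsMap_smul, map_sub,
    AnomalousReduction.localRed_smul_eq_of_anomalous W p hpv hΔ hord hanom h hPtors, sub_self]

variable (τ : Field.absoluteGaloisGroup (κ.layer n))
  (hτ : ι' = (closureEmb (K := κ.layer n) (wp.adicCompletion (κ.layer n))).comp
    ((show AlgebraicClosure (κ.layer n) ≃ₐ[κ.layer n] AlgebraicClosure (κ.layer n) from τ) :
      AlgebraicClosure (κ.layer n) →ₐ[κ.layer n] AlgebraicClosure (κ.layer n)))

include hpv hΔ hι₂ hcompat hw' hred hτ in
/-- **`hs_anom` of the local package: `red(pointsMap(res g • Q)) = red(pointsMap Q)`** for all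
`g ∈ Γ_{L_w}` and `Q ∈ E[p]` (anomalous good ordinary `p`). With `ι' = ι_{L_w} ∘ τ`:
`pointsMap R = (ι')_* (τ⁻¹ • R)` (`pointsMapOfEmb_comp`) and `res_{ι'} g = τ⁻¹ (res g) τ`
(`resGalOfEmb_comp`), so the claim is §2's for `Q' = τ⁻¹ • Q`.
[cite: GreenbergLNM1716, §3 Lemma 3.4 (p. 89)] [cite: SerreGaloisCohomology1997, II.§1.1] -/
theorem red_pointsMap_smul_eq [NumberField (κ.layer n)]
    (hord : ¬ (p : ℤ) ∣ W.frobeniusTrace p) (hanom : p ∣ W.reductionPointCount p)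
    (hΔ' : IsUnit M'.Δ) (g : absoluteGaloisGroup (wp.adicCompletion (κ.layer n)))
    (Q : geomTorsion (W.baseChange (κ.layer n)) (p : ℤ)) :
    red (pointsMap (W.baseChange (κ.layer n)) (wp.adicCompletion (κ.layer n))
        ((absGaloisRestrict (κ.layer n) (wp.adicCompletion (κ.layer n)) g • Q :
            geomTorsion (W.baseChange (κ.layer n)) (p : ℤ)) :
          WeierstrassCurve.geomPoints (W.baseChange (κ.layer n)))) =
      red (pointsMap (W.baseChange (κ.layer n)) (wp.adicCompletion (κ.layer n))
        (Q : WeierstrassCurve.geomPoints (W.baseChange (κ.layer n)))) := by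
  rw [← sub_eq_zero]
  -- `pointsMap R = (ι')_* (τ⁻¹ • R)`
  have hpm : ∀ R : WeierstrassCurve.geomPoints (W.baseChange (κ.layer n)),
      pointsMap (W.baseChange (κ.layer n)) (wp.adicCompletion (κ.layer n)) R =
        pointsMapOfEmb (W.baseChange (κ.layer n)) ι' (τ⁻¹ • R) := by
    intro R
    have h1 := congrArg (fun f ↦ f (τ⁻¹ • R)) (pointsMapOfEmb_comp (W.baseChange (κ.layer n))
      (closureEmb (K := κ.layer n) (wp.adicCompletion (κ.layer n)))
      (show AlgebraicClosure (κ.layer n) ≃ₐ[κ.layer n] AlgebraicClosure (κ.layer n) from τ))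
    rw [← hτ] at h1
    simp only [AddMonoidHom.coe_comp, Function.comp_apply, DistribSMul.toAddMonoidHom_apply,
      smul_inv_smul] at h1
    exact h1.symm
  -- `res_{ι'} g = τ⁻¹ (res g) τ`
  have hres : resGalOfEmb ι' g =
      τ⁻¹ * absGaloisRestrict (κ.layer n) (wp.adicCompletion (κ.layer n)) g * τ := by
    have h1 := congrArg (fun f ↦ f g) (resGalOfEmb_comp
      (closureEmb (K := κ.layer n) (wp.adicCompletion (κ.layer n)))
      (show AlgebraicClosure (κ.layer n) ≃ₐ[κ.layer n] AlgebraicClosure (κ.layer n) from τ))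
    rw [← hτ] at h1
    rw [h1, ← resGal_eq_absGaloisRestrict]
    rfl
  have key := red_pointsMapOfEmb_smul_sub_eq_zero W κ n hpv hΔ wp hw' hMK' hred ι₂ hι₂ ι' hcompat
    hord hanom hΔ' g (τ⁻¹ • Q)
  have e1 : pointsMap (W.baseChange (κ.layer n)) (wp.adicCompletion (κ.layer n))
      ((absGaloisRestrict (κ.layer n) (wp.adicCompletion (κ.layer n)) g • Q :
          geomTorsion (W.baseChange (κ.layer n)) (p : ℤ)) :
        WeierstrassCurve.geomPoints (W.baseChange (κ.layer n))) =
      pointsMapOfEmb (W.baseChange (κ.layer n)) ι'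
        ((resGalOfEmb ι' g • (τ⁻¹ • Q) : geomTorsion (W.baseChange (κ.layer n)) (p : ℤ)) :
          WeierstrassCurve.geomPoints (W.baseChange (κ.layer n))) := by
    rw [hpm]
    simp only [Literature.NumberTheory.EllipticCurves.AddSubgroup.torsionBy.coe_smul, hres, mul_smul,
      smul_inv_smul]
  have e2 : pointsMap (W.baseChange (κ.layer n)) (wp.adicCompletion (κ.layer n))
      (Q : WeierstrassCurve.geomPoints (W.baseChange (κ.layer n))) =
      pointsMapOfEmb (W.baseChange (κ.layer n)) ι'
        ((τ⁻¹ • Q : geomTorsion (W.baseChange (κ.layer n)) (p : ℤ)) :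
          WeierstrassCurve.geomPoints (W.baseChange (κ.layer n))) := by
    rw [hpm, Literature.NumberTheory.EllipticCurves.AddSubgroup.torsionBy.coe_smul]
  refine (congrArg₂ (fun a b ↦ red a - red b) e1 e2).trans ?_
  rw [← map_sub, ← map_sub]
  exact key

/-! ## §3. `hI` and `hμ`: the cyclotomic tower over `L_w` -/

include hκn hpv hι₂ hcompat hfix hτ in
/-- **Some inertia element `g ∈ I_{L_w}` has `κ_n(res g) ∈ ℤ_pˣ`** (`κ` cyclotomic, `v ∋ p`): take
`σ₀ ∈ Γ_ℚ` with `κ σ₀ = pⁿ`, write `σ₀ = res(d) · k` with `d ∈ I_{ℚ_v}`, `k ∈ ker κ` (FILE 22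
`exists_absInertia_mul_mem_kerSubgroup`), so `κ(res d) = pⁿ`, `res d ∈ Gal(\bar ℚ/ℚ_n)`; then
`g = ι₂ d ι₂⁻¹ ∈ I_{L_w}` (`X1/SpectralNormTransport`) and `κ_n(res g) · pⁿ = κ(res d) = pⁿ`.
[cite: SerreLocalFields1979, Ch. IV §4 Prop. 17] [cite: Washington1997, §13.1] -/
theorem exists_absInertia_not_dvd [NumberField (κ.layer n)] (hκ : κ.IsCyclotomic) :
    ∃ g ∈ absInertia (wp.adicCompletion (κ.layer n)),
      ¬ (p : ℤ_[p]) ∣ (κn (absGaloisRestrict (κ.layer n) (wp.adicCompletion (κ.layer n)) g)).toAdd := by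
  set Lw := wp.adicCompletion (κ.layer n)
  obtain ⟨σ₀, hσ₀⟩ := κ.surjective (Multiplicative.ofAdd ((p : ℤ_[p]) ^ n))
  obtain ⟨d, hdI, hk⟩ :=
    Summit.BirchSwinnertonDyer.Rank1Residual.X1.LocalKerOverAtPConj.exists_absInertia_mul_mem_kerSubgroup
      κ hκ hpv σ₀
  have hκd : (κ (absGaloisRestrict ℚ (v.adicCompletion ℚ) d)).toAdd = (p : ℤ_[p]) ^ n := by
    have h1 : κ ((absGaloisRestrict ℚ (v.adicCompletion ℚ) d)⁻¹ * σ₀) = 1 := hk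
    rw [map_mul, map_inv, inv_mul_eq_one] at h1
    have h2 : κ (absGaloisRestrict ℚ (v.adicCompletion ℚ) d) = Multiplicative.ofAdd ((p : ℤ_[p]) ^ n) := by
      rw [h1]; exact hσ₀
    rw [h2]; rfl
  have hmem : resGalOfEmb (closureEmb (K := ℚ) (v.adicCompletion ℚ)) d ∈ κ.layerSubgroup n := by
    rw [ZpExtension.mem_layerSubgroup]
    change (p : ℤ_[p]) ^ n ∣ (κ (absGaloisRestrict ℚ (v.adicCompletion ℚ) d)).toAdd
    rw [hκd]
  set g := transportAut ι₂ d (hfix d hmem) with hg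
  refine ⟨g, (Summit.BirchSwinnertonDyer.Rank1Residual.X1.SpectralNormTransport.transportAut_mem_absInertia_iff
    (κ.layer n) v wp ι₂ hι₂ d (hfix d hmem)).mpr hdI, fun hdvd ↦ ?_⟩
  -- `κ_n(res_{ι'} g) = κ_n(res g)` and `κ_n(res_{ι'} g) · pⁿ = κ(res d) = pⁿ`
  have hres : resGalOfEmb ι' g = τ⁻¹ * absGaloisRestrict (κ.layer n) Lw g * τ := by
    have h1 := congrArg (fun f ↦ f g) (resGalOfEmb_comp (closureEmb (K := κ.layer n) Lw)
      (show AlgebraicClosure (κ.layer n) ≃ₐ[κ.layer n] AlgebraicClosure (κ.layer n) from τ))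
    rw [← hτ] at h1
    rw [h1, ← resGal_eq_absGaloisRestrict]
    rfl
  have hx : resGal (K := ℚ) (κ.layer n) (resGalOfEmb ι' g) =
      resGalOfEmb (closureEmb (K := ℚ) (v.adicCompletion ℚ)) d :=
    resGal_resGalOfEmb_transportAut (κ.layer n) (closureEmb (K := ℚ) (v.adicCompletion ℚ))
      ι₂ ι' hcompat d (hfix d hmem)
  have hconj : κn (resGalOfEmb ι' g) = κn (absGaloisRestrict (κ.layer n) Lw g) := by
    rw [hres, map_mul κn, map_mul κn, map_inv κn, mul_assoc, mul_comm (κn _) (κn τ), ← mul_assoc,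
      inv_mul_cancel, one_mul]
  have h3 := hκn (resGalOfEmb ι' g)
  rw [hx, hconj] at h3
  change (κn (absGaloisRestrict (κ.layer n) Lw g)).toAdd * (p : ℤ_[p]) ^ n =
    (κ (absGaloisRestrict ℚ (v.adicCompletion ℚ) d)).toAdd at h3
  rw [hκd] at h3
  have h4 : (κn (absGaloisRestrict (κ.layer n) Lw g)).toAdd = 1 :=
    (mul_eq_right₀ (pow_ne_zero _ (NeZero.ne _))).mp h3
  rw [h4] at hdvd
  exact PadicInt.irreducible_p.not_isUnit (isUnit_of_dvd_one hdvd)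

include hpv hfix in
omit [wp.asIdeal.LiesOver v.asIdeal] in
/-- **No non-trivial `p`-th root of unity of `\bar L_w` is fixed by `Γ_{L_w}`** (`p` odd, `κ`
cyclotomic, `v ∋ p`): an inertia element `d ∈ I_{ℚ_v}` with cyclotomic character `−1` (local
Kronecker–Weber in inertia form, tree `adicCompletion_rat_exists_mem_absInertia_cyclotomicCharacter_eq`)
restricts into `ker κ ⊆ Gal(\bar ℚ/ℚ_n)`, so `ι₂ d ι₂⁻¹ ∈ Γ_{L_w}`; it INVERTS `μ_p`, hence fixes only
`1`. [cite: SerreLocalFields1979, Ch. IV §4 Prop. 17] [cite: Washington1997, §13.1] -/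
theorem forall_mu_eq_zero [NumberField (κ.layer n)] (hκ : κ.IsCyclotomic) (hodd : p ≠ 2)
    (ζ : MuCarrier (wp.adicCompletion (κ.layer n)) (p ^ 1))
    (hζ : ∀ σ : absoluteGaloisGroup (wp.adicCompletion (κ.layer n)),
      mu (wp.adicCompletion (κ.layer n)) (p ^ 1) σ ζ = ζ) : ζ = 0 := by
  set Lw := wp.adicCompletion (κ.layer n)
  have hv : ((Rat.HeightOneSpectrum.primesEquiv v : Nat.Primes) : ℕ) = p :=
    LocalField.primesEquiv_eq_of_natCast_mem p v hpv
  obtain ⟨d, -, hd⟩ := adicCompletion_rat_exists_mem_absInertia_cyclotomicCharacter_eq p v hv (-1)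
  -- `res d ∈ ker κ ⊆ Gal(\bar ℚ/ℚ_n)`
  have hker : absGaloisRestrict ℚ (v.adicCompletion ℚ) d ∈ κ.kerSubgroup := by
    rw [hκ, Subgroup.mem_comap]
    change GaloisRep.cyclotomicCharacter ℚ p (absGaloisRestrict ℚ (v.adicCompletion ℚ) d) ∈
      CommGroup.torsion ℤ_[p]ˣ
    rw [cyclotomicCharacter_absGaloisRestrict, hd, CommGroup.mem_torsion]
    exact isOfFinOrder_iff_pow_eq_one.mpr ⟨2, two_pos, by rw [neg_one_sq]⟩
  have hmem : resGalOfEmb (closureEmb (K := ℚ) (v.adicCompletion ℚ)) d ∈ κ.layerSubgroup n :=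
    κ.kerSubgroup_le_layerSubgroup n hker
  set g := transportAut ι₂ d (hfix d hmem) with hg
  -- the root of unity `t' ∈ \bar L_w`, `t = ι₂⁻¹ t' ∈ \bar ℚ_v`
  set r : rootsOfUnity (p ^ 1) (AlgebraicClosure Lw) := (MuCarrier.toAdditive ζ).toMul with hr
  set t' : AlgebraicClosure Lw := ((r : (AlgebraicClosure Lw)ˣ) : AlgebraicClosure Lw) with ht'
  set t : AlgebraicClosure (v.adicCompletion ℚ) := ι₂.symm t' with ht
  have hr1 : t' ^ p ^ 1 = 1 := by
    rw [ht', ← Units.val_pow_eq_pow_val, (mem_rootsOfUnity _ _).mp r.2, Units.val_one]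
  have htp : t ^ p ^ 1 = 1 := by rw [ht, ← map_pow, hr1, map_one]
  -- `g` fixes `t'`, so `d` fixes `t`
  have hgt' : (show AlgebraicClosure Lw ≃ₐ[Lw] AlgebraicClosure Lw from g) t' = t' := by
    have h2 : MuCarrier.toAdditive (mu Lw (p ^ 1) g ζ) = MuCarrier.toAdditive ζ := by rw [hζ g]
    rw [DiscreteGaloisModule.mu_apply_apply] at h2
    have h3 : g • r = r := Additive.ofMul.injective h2
    have h4 := congrArg (fun u : rootsOfUnity (p ^ 1) (AlgebraicClosure Lw) ↦
      ((u : (AlgebraicClosure Lw)ˣ) : AlgebraicClosure Lw)) h3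
    simp only [Field.absoluteGaloisGroup.coe_smul_rootsOfUnity, Units.coe_smul] at h4
    exact h4
  have hdt : d • t = t := by
    apply ι₂.injective
    change ι₂ ((show AlgebraicClosure (v.adicCompletion ℚ) ≃ₐ[v.adicCompletion ℚ]
      AlgebraicClosure (v.adicCompletion ℚ) from d) (ι₂.symm t')) = ι₂ (ι₂.symm t')
    rw [← transportAut_apply ι₂ d (hfix d hmem), RingEquiv.apply_symm_apply]
    exact hgt'
  -- `d` acts on `μ_p` through `χ(d) = -1`
  haveI : CharZero (v.adicCompletion ℚ) := charZero_adicCompletion v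
  haveI : NeZero ((p : ℕ) : v.adicCompletion ℚ) := ⟨Nat.cast_ne_zero.mpr hp.out.ne_zero⟩
  have hspec := GaloisRep.cyclotomicCharacter_spec (K := v.adicCompletion ℚ) (ℓ := p) (k := 1) d t htp
  rw [hd, hdt] at hspec
  have hm : p ^ 1 ∣ (((-1 : ℤ_[p]ˣ) : ℤ_[p]).toZModPow 1).val + 1 := by
    rw [← ZMod.natCast_eq_zero_iff, Nat.cast_add, ZMod.natCast_zmod_val, Nat.cast_one,
      Units.val_neg, Units.val_one, map_neg, map_one, neg_add_cancel]
  have ht2 : t ^ 2 = 1 := by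
    obtain ⟨k, hk⟩ := hm
    have h1 : t ^ ((((-1 : ℤ_[p]ˣ) : ℤ_[p]).toZModPow 1).val + 1) = 1 := by
      rw [hk, pow_mul, htp, one_pow]
    rwa [pow_succ, ← hspec, ← sq] at h1
  have htp1 : t ^ p = 1 := by rw [pow_one] at htp; exact htp
  have ht1 : t = 1 := by
    have h : t ^ Nat.gcd 2 p = 1 := pow_gcd_eq_one.mpr ⟨ht2, htp1⟩
    rwa [(Nat.coprime_two_left.mpr (hp.out.odd_of_ne_two hodd)).gcd_eq_one, pow_one] at h
  have ht'1 : t' = 1 := by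
    rw [← ι₂.apply_symm_apply t', ← ht, ht1, map_one]
  have hr : r = 1 := by
    apply Subtype.ext
    apply Units.ext
    rw [← ht', ht'1]
    rfl
  change MuCarrier.toAdditive ζ = 0
  change Additive.ofMul r = 0
  rw [hr]
  rfl

end Summit.BirchSwinnertonDyer.Rank1Residual.X1.LocalPackageTransportGalois

end
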